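import Summits.Ventures.PercRepro.SixFourResidueThreeBetaCounts

/-!
# The `t = 3` clause of `SixFourResidue` — plane + `k` points for EVERY plane size, part 2: the additive bounds (p2, gen 9)

`20·J₃(G) ≥ A20 k p + Σ_λ B20 k p m_λ` for `G = τ ⊔ {a}` (`k = 1`, `J_three_ge_additive₁`) and `G = τ ⊔ {a, a′}` (`k = 2`,
`J_three_ge_additive₂`) with `τ = P₀ ∩ G` a rank-`3` plane trace of any size, from the share / demand bounds of
`SixFourResidueThreeOnePoint` / `ThreeTwoPointsA–C` and the line-sum counts of part 1 (`SixFourResidueThreeBetaCounts.lean`).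
-/

namespace PercRepro.SixFour

open Finset ThmH

variable {α : Type*} [DecidableEq α] {M : Matroid α} [M.Finite] {G : Finset α}

/-! ## The additive bounds -/

section Additive

/-- `Σ_λ B20 k p m_λ` split into its line sums (`k = 1`). -/
theorem sum_B20_one (τ : Finset α) :
    ∑ L ∈ lines M, ((B20 1 τ.card (L ∩ τ).card : ℤ) : ℚ) =
      -12 * ∑ L ∈ lines M, (((L ∩ τ).card.choose 3 : ℤ) : ℚ) - 30 * ∑ L ∈ lines M, ((delta (L ∩ τ).card : ℤ) : ℚ) -
        10 * ∑ L ∈ lines M, (((eps (L ∩ τ).card : ℤ) * ((τ.card - (L ∩ τ).card : ℕ) : ℤ) : ℤ) : ℚ) +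
        24 * (∑ L ∈ lines M, ((smallTot (L ∩ τ).card τ.card 3 : ℤ) : ℚ) + ∑ L ∈ lines M, ((collCount (L ∩ τ).card : ℤ) : ℚ)) := by
  simp only [B20, if_true, Finset.mul_sum, ← Finset.sum_add_distrib, ← Finset.sum_sub_distrib]
  refine Finset.sum_congr rfl (fun L _ => ?_)
  push_cast
  ring

/-- `Σ_λ B20 k p m_λ` split into its line sums (`k = 2`). -/
theorem sum_B20_two (τ : Finset α) :
    ∑ L ∈ lines M, ((B20 2 τ.card (L ∩ τ).card : ℤ) : ℚ) =
      -39 * ∑ L ∈ lines M, (((L ∩ τ).card.choose 3 : ℤ) : ℚ) - 120 * ∑ L ∈ lines M, ((delta (L ∩ τ).card : ℤ) : ℚ) -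
        50 * ∑ L ∈ lines M, (((eps (L ∩ τ).card : ℤ) * ((τ.card - (L ∩ τ).card : ℕ) : ℤ) : ℤ) : ℚ) +
        24 * (∑ L ∈ lines M, ((smallTot (L ∩ τ).card τ.card 3 : ℤ) : ℚ) + ∑ L ∈ lines M, ((collCount (L ∩ τ).card : ℤ) : ℚ)) +
        48 * ∑ L ∈ lines M, ((smallTot (L ∩ τ).card τ.card 2 : ℤ) : ℚ) - 4 * ∑ L ∈ lines M, ((eps (L ∩ τ).card : ℤ) : ℚ) := by
  simp only [B20, Finset.mul_sum, ← Finset.sum_add_distrib, ← Finset.sum_sub_distrib]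
  refine Finset.sum_congr rfl (fun L _ => ?_)
  simp only [show (2 : ℕ) = 1 ↔ False from by decide, if_false]
  push_cast
  ring

variable (hs : Simple M) (hG : G ⊆ gr M) {P₀ : Finset α} (hP₀ : P₀ ∈ planes M)
include hs hG hP₀

/-- **The additive bound at `k = 1`** (every plane size): `A20 1 p + Σ_λ B20 1 p m_λ ≤ 20·J₃(G)` when `G ∖ P₀ = {a}` and
`τ = P₀ ∩ G` has rank `3`. -/
theorem J_three_ge_additive₁ {a : α} (ht : OneOff M G P₀ a) (hr3 : M.eRk ((P₀ ∩ G : Finset α) : Set α) = 3) :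
    ((A20 1 (P₀ ∩ G).card : ℤ) : ℚ) + ∑ L ∈ lines M, ((B20 1 (P₀ ∩ G).card (L ∩ (P₀ ∩ G)).card : ℤ) : ℚ) ≤
      20 * J M G 3 := by
  set τ := P₀ ∩ G with hτdef
  have hτ : τ ⊆ gr M := Finset.inter_subset_right.trans hG
  have hshares := J_three_ge_shares ht hG hP₀
  rw [← hτdef] at hshares
  have hsum := share3_sum_ge hs hτ
  have hdem := dem3_sum_add_collSum_le hs hτ hr3
  have hT := Tcnt_eq_all hs hτ hr3
  have hD := D3cnt_eq_all hs hτ hr3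
  have hLP := LPcnt_le_all hs hτ
  have hS := card_small_eq_all hs hτ hr3 3
  have hB := sum_B20_one (M := M) τ
  rw [hB]
  have hTq : (Tcnt M τ : ℚ) = (τ.card.choose 3 : ℚ) - ∑ L ∈ lines M, (((L ∩ τ).card.choose 3 : ℤ) : ℚ) := by
    have := congrArg (fun x : ℤ => (x : ℚ)) hT
    push_cast at this ⊢
    linarith
  have hDq : (D3cnt M τ : ℚ) = (delta τ.card : ℚ) - ∑ L ∈ lines M, ((delta (L ∩ τ).card : ℤ) : ℚ) := by
    have := congrArg (fun x : ℤ => (x : ℚ)) hD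
    push_cast at this ⊢
    linarith
  have hLPq : (LPcnt M τ : ℚ) ≤ ∑ L ∈ lines M, (((eps (L ∩ τ).card : ℤ) * ((τ.card - (L ∩ τ).card : ℕ) : ℤ) : ℤ) : ℚ) := by
    have := (Int.cast_le (R := ℚ)).2 hLP
    push_cast at this ⊢
    exact this
  have hSq : (((R3 M τ).filter (fun S => S.card + 3 ≤ τ.card)).card : ℚ) =
      (smallTot τ.card τ.card 3 : ℚ) - ∑ L ∈ lines M, ((smallTot (L ∩ τ).card τ.card 3 : ℤ) : ℚ) := by
    have := congrArg (fun x : ℤ => (x : ℚ)) hS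
    push_cast at this ⊢
    linarith
  unfold A20
  simp only [if_true]
  push_cast at hshares hsum hdem hTq hDq hLPq hSq ⊢
  linarith [hshares, hsum, hdem, hTq, hDq, hLPq, hSq]

/-- **The additive bound at `k = 2`** (every plane size): `A20 2 p + Σ_λ B20 2 p m_λ ≤ 20·J₃(G)` when `G ∖ P₀ = {a, a′}` and
`τ = P₀ ∩ G` has rank `3`. -/
theorem J_three_ge_additive₂ (hr : M.eRk (G : Set α) = 4) {a a' : α} (ht : TwoOff M G P₀ a a')
    (hr3 : M.eRk ((P₀ ∩ G : Finset α) : Set α) = 3) :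
    ((A20 2 (P₀ ∩ G).card : ℤ) : ℚ) + ∑ L ∈ lines M, ((B20 2 (P₀ ∩ G).card (L ∩ (P₀ ∩ G)).card : ℤ) : ℚ) ≤
      20 * J M G 3 := by
  set τ := P₀ ∩ G with hτdef
  have hτ : τ ⊆ gr M := Finset.inter_subset_right.trans hG
  have hshares := J_three_ge_shares₂ ht hG hr hP₀ hs
  rw [← hτdef] at hshares
  have hsum := share3C_sum_ge hs hτ
  have hdem2 := dem2_sum_le (M := M) (τ := τ)
  have hdem3 := dem3_sum_add_collSum_le hs hτ hr3
  have hbeta := beta_sum_ge_all (M := M) hτ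
  have hT := Tcnt_eq_all hs hτ hr3
  have hD := D3cnt_eq_all hs hτ hr3
  have hLP := LPcnt_le_all hs hτ
  have hS3 := card_small_eq_all hs hτ hr3 3
  have hS2 := card_small_eq_all hs hτ hr3 2
  have hB := sum_B20_two (M := M) τ
  rw [hB]
  have hsplit : ∑ B ∈ R3 M τ, (share3C M B - 12 / 5 * dem2 M τ B - 6 / 5 * dem3 M τ B) =
      ∑ B ∈ R3 M τ, share3C M B - 12 / 5 * ∑ B ∈ R3 M τ, dem2 M τ B - 6 / 5 * ∑ B ∈ R3 M τ, dem3 M τ B := by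
    rw [Finset.sum_sub_distrib, Finset.sum_sub_distrib, Finset.mul_sum, Finset.mul_sum]
  rw [hsplit] at hshares
  have hTq : (Tcnt M τ : ℚ) = (τ.card.choose 3 : ℚ) - ∑ L ∈ lines M, (((L ∩ τ).card.choose 3 : ℤ) : ℚ) := by
    have := congrArg (fun x : ℤ => (x : ℚ)) hT
    push_cast at this ⊢
    linarith
  have hDq : (D3cnt M τ : ℚ) = (delta τ.card : ℚ) - ∑ L ∈ lines M, ((delta (L ∩ τ).card : ℤ) : ℚ) := by
    have := congrArg (fun x : ℤ => (x : ℚ)) hD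
    push_cast at this ⊢
    linarith
  have hLPq : (LPcnt M τ : ℚ) ≤ ∑ L ∈ lines M, (((eps (L ∩ τ).card : ℤ) * ((τ.card - (L ∩ τ).card : ℕ) : ℤ) : ℤ) : ℚ) := by
    have := (Int.cast_le (R := ℚ)).2 hLP
    push_cast at this ⊢
    exact this
  have hS3q : (((R3 M τ).filter (fun S => S.card + 3 ≤ τ.card)).card : ℚ) =
      (smallTot τ.card τ.card 3 : ℚ) - ∑ L ∈ lines M, ((smallTot (L ∩ τ).card τ.card 3 : ℤ) : ℚ) := by
    have := congrArg (fun x : ℤ => (x : ℚ)) hS3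
    push_cast at this ⊢
    linarith
  have hS2q : (((R3 M τ).filter (fun S => S.card + 2 ≤ τ.card)).card : ℚ) =
      (smallTot τ.card τ.card 2 : ℚ) - ∑ L ∈ lines M, ((smallTot (L ∩ τ).card τ.card 2 : ℤ) : ℚ) := by
    have := congrArg (fun x : ℤ => (x : ℚ)) hS2
    push_cast at this ⊢
    linarith
  unfold A20
  simp only [show (2 : ℕ) = 1 ↔ False from by decide, if_false]
  push_cast at hshares hsum hdem2 hdem3 hbeta hTq hDq hLPq hS3q hS2q ⊢
  linarith [hshares, hsum, hdem2, hdem3, hbeta, hTq, hDq, hLPq, hS3q, hS2q]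

end Additive

end PercRepro.SixFour
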